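import Summits.ValiantsHypothesis.ValiantsHypothesis.Theorems.LacunarySymmetroidMatrixDescartesDoorA26WallBubblingTwoScaleDoubletonSplit
import Summits.ValiantsHypothesis.ValiantsHypothesis.Theorems.LacunarySymmetroidMatrixDescartesDoorA26WallBubblingTwoPairTwoScaleMonotone

/-!
# Wall bubbling for `DoorA26` — TWO WEYL PAIRS: THE MIXED CLASS, TOP RULE (face form) — `MixTop26` IS A LEMMA

HONEST FRAMING.  Obligation (W) `stub_weylFaces` of `Cruxes/DoorA26/Lines/wall_bubbling.lean` (crux `DoorA26`, stmt-ValiantsHypothesis-19979; OPEN,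
typed, never asserted); W1 seat val-sym-door-p2 g14.  Rev 8 of `Cruxes/DoorA26/Lines/wall_bubbling_ConfluentDoor.lean` reduces (W_wall) to three
face-form rules for the 4-member mixed class `δ₀+δ₁ = {(0,1) deg 0; (0,4),(5,1) deg 1; (5,4) deg 2}` at a two-Weyl-pair point (`MixTop26`,
`MixMid26`, `MixThree26`, typed there, hypotheses `hMixTop/hMixMid/hMixThree` of W1 #52 `twoPair_noTwenties_of_mixedRules`).  THIS FILE PROVES THE
FIRST ONE OUTRIGHT, at its face-form binder byte-exact:

* **`mixTop_face`** `(δ0) (h50 : δ0 5 = δ0 0) (h41 : δ0 4 = δ0 1) … : Γ 5 4 ≠ 0 → Γ' 5 4 = 0 ∧ Γ' 0 4 = 0 ∧ Γ' 5 1 = 0` — so `MixTop26` of rev 8 is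
  closed by `fun δ0 h50 h41 => mixTop_face δ0 h50 h41` (the line lead's link).

Mechanism (crit-2 g5's face-domination calculus, `mix_rules_face_domination.md` f13ad36479d39fd7 §3, made exact).  Under the two transvections of
W1 #46 `frame_shift₂` the mixed entries transform TRIANGULARLY (`mixed_frameShift`): `g'₅₄ = E₀E₁ee'·g₅₄`, `g'₀₄ = E₀E₁e'(g₀₄ + Λg₅₄)`,
`g'₅₁ = E₀E₁e(g₅₁ + Λ'g₅₄)`, `g'₀₁ = E₀E₁(g₀₁ + Λg₅₁ + Λ'g₀₄ + ΛΛ'g₅₄)` with `E₀ = e^{δ₀L}`, `E₁ = e^{δ₁L}`, `e = e^{wL}`, `e' = e^{w'L}`,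
`w = δ₅−δ₀ → 0`, `w' = δ₄−δ₁ → 0`, `Λ = dslope (y ↦ e^{yL}) 0 w`, `Λ' = dslope (y ↦ e^{yL}) 0 w'`.  If `(5,4)` is alive upstream (`κμ ≤ |g₅₄|`) then
downstream `(5,4)` alive would force `|Λ| ≤ e/κ' + 1/κ` (domination by `g'₀₄`, `mixTop_core_deg2`), and `(0,4)` [resp. `(5,1)`] alive would force
`|Λ| < 1 + 2/κ` once `|Λ'| > e'/κ' + 2/κ` [resp. the mirror] (domination by `g'₀₁`, `mixTop_core_deg1`) — each contradicting W2's
`eventually_dslope_exp_gt` (`|Λ|` outgrows `a·e^{wL} + b`).  No symmetry of the letters and no value-genericity is needed for this rule.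

Registers unchanged; (W), `ConfluentDoor26`, `NoTightChain26(NC)`, `MixMid26`, `MixThree26`, `DoorA26` 19979, 18050 OPEN, typed never asserted; nothing
on VP ≠ VNP.  Def-free.  `--supports stmt-ValiantsHypothesis-19979 --as helper`.  [this work]
-/

-- `Summit.ValiantsHypothesis.ValiantsHypothesis.…` repeats a component by the D-0017 layout
-- (single-conjunct summit), which the `dupNamespace` linter flags; the name is mandated.
set_option linter.dupNamespace false

namespace Summit.ValiantsHypothesis.ValiantsHypothesis.Theorems.LacunarySymmetroidMatrixDescartes.WallBubbling

open Finset Filter Topology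
open Bubbling (polar polar_apply polar_comm polar_smul_left_right)
open scoped BigOperators

/-! ## 1. The mixed entries across two scales -/

/-- `polar` of two transvected-rescaled vectors with two different directions. [folklore] -/
theorem polar_shift_expand₂ (X Y Z W : Matrix (Fin 2) (Fin 2) ℝ) (a b c d : ℝ) :
    polar (a • (X + c • Z)) (b • (Y + d • W)) = a * b * (polar X Y + d * polar X W + c * polar Z Y + c * d * polar Z W) := by
  rw [polar_smul_left_right, polar_add_smul_left, polar_comm X (Y + d • W), polar_add_smul_left, polar_comm Z (Y + d • W),
    polar_add_smul_left, polar_comm Y X, polar_comm W X, polar_comm Y Z, polar_comm W Z]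
  ring

/-- **THE MIXED CLASS ACROSS TWO SCALES** (from W1 #46 `frame_shift₂`): with `E₀ = e^{δ₀L}`, `E₁ = e^{δ₁L}`, `e = e^{(δ₅−δ₀)L}`, `e' = e^{(δ₄−δ₁)L}`,
`Λ = dslope (y ↦ e^{yL}) 0 (δ₅−δ₀)`, `Λ' = dslope (y ↦ e^{yL}) 0 (δ₄−δ₁)`:
`g'₅₄ = E₀E₁ee'g₅₄`, `g'₀₄ = E₀E₁e'(g₀₄ + Λg₅₄)`, `g'₅₁ = E₀E₁e(g₅₁ + Λ'g₅₄)`, `g'₀₁ = E₀E₁(g₀₁ + Λ'g₀₄ + Λg₅₁ + ΛΛ'g₅₄)`. [this work] -/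
theorem mixed_frameShift (δ : Fin 6 → ℝ) (U : Fin 6 → Matrix (Fin 2) (Fin 2) ℝ) (L : ℝ) :
    polar ((δ 5 - δ 0) • (Real.exp (δ 5 * L) • U 5)) ((δ 4 - δ 1) • (Real.exp (δ 4 * L) • U 4))
        = Real.exp (δ 0 * L) * Real.exp (δ 1 * L) * (Real.exp ((δ 5 - δ 0) * L) * Real.exp ((δ 4 - δ 1) * L))
          * polar ((δ 5 - δ 0) • U 5) ((δ 4 - δ 1) • U 4) ∧
    polar (Real.exp (δ 0 * L) • U 0 + Real.exp (δ 5 * L) • U 5) ((δ 4 - δ 1) • (Real.exp (δ 4 * L) • U 4))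
        = Real.exp (δ 0 * L) * Real.exp (δ 1 * L) * Real.exp ((δ 4 - δ 1) * L)
          * (polar (U 0 + U 5) ((δ 4 - δ 1) • U 4)
            + dslope (fun y : ℝ => Real.exp (y * L)) 0 (δ 5 - δ 0) * polar ((δ 5 - δ 0) • U 5) ((δ 4 - δ 1) • U 4)) ∧
    polar ((δ 5 - δ 0) • (Real.exp (δ 5 * L) • U 5)) (Real.exp (δ 1 * L) • U 1 + Real.exp (δ 4 * L) • U 4)
        = Real.exp (δ 0 * L) * Real.exp (δ 1 * L) * Real.exp ((δ 5 - δ 0) * L)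
          * (polar ((δ 5 - δ 0) • U 5) (U 1 + U 4)
            + dslope (fun y : ℝ => Real.exp (y * L)) 0 (δ 4 - δ 1) * polar ((δ 5 - δ 0) • U 5) ((δ 4 - δ 1) • U 4)) ∧
    polar (Real.exp (δ 0 * L) • U 0 + Real.exp (δ 5 * L) • U 5) (Real.exp (δ 1 * L) • U 1 + Real.exp (δ 4 * L) • U 4)
        = Real.exp (δ 0 * L) * Real.exp (δ 1 * L)
          * (polar (U 0 + U 5) (U 1 + U 4)
            + dslope (fun y : ℝ => Real.exp (y * L)) 0 (δ 4 - δ 1) * polar (U 0 + U 5) ((δ 4 - δ 1) • U 4)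
            + dslope (fun y : ℝ => Real.exp (y * L)) 0 (δ 5 - δ 0) * polar ((δ 5 - δ 0) • U 5) (U 1 + U 4)
            + dslope (fun y : ℝ => Real.exp (y * L)) 0 (δ 5 - δ 0) * dslope (fun y : ℝ => Real.exp (y * L)) 0 (δ 4 - δ 1)
              * polar ((δ 5 - δ 0) • U 5) ((δ 4 - δ 1) • U 4)) := by
  have f01 : ((0 : Fin 6) = 1) = False := by simp
  have f04 : ((0 : Fin 6) = 4) = False := by simp
  have f05 : ((0 : Fin 6) = 5) = False := by simp
  have f10 : ((1 : Fin 6) = 0) = False := by simp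
  have f14 : ((1 : Fin 6) = 4) = False := by simp
  have f15 : ((1 : Fin 6) = 5) = False := by simp
  have hs0 := frame_shift₂ δ U L 0
  simp only [f01, f04, f05, if_true, if_false, zero_smul, add_zero] at hs0
  have hs1 := frame_shift₂ δ U L 1
  simp only [f10, f14, f15, if_true, if_false, zero_smul, add_zero] at hs1
  have hs5 : (δ 5 - δ 0) • (Real.exp (δ 5 * L) • U 5)
      = Real.exp (δ 5 * L) • ((δ 5 - δ 0) • U 5 + (0 : ℝ) • ((δ 5 - δ 0) • U 5)) := by
    rw [zero_smul, add_zero, smul_comm]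
  have hs4 : (δ 4 - δ 1) • (Real.exp (δ 4 * L) • U 4)
      = Real.exp (δ 4 * L) • ((δ 4 - δ 1) • U 4 + (0 : ℝ) • ((δ 4 - δ 1) • U 4)) := by
    rw [zero_smul, add_zero, smul_comm]
  have he5 : Real.exp (δ 5 * L) = Real.exp (δ 0 * L) * Real.exp ((δ 5 - δ 0) * L) := by
    rw [← Real.exp_add]; congr 1; ring
  have he4 : Real.exp (δ 4 * L) = Real.exp (δ 1 * L) * Real.exp ((δ 4 - δ 1) * L) := by
    rw [← Real.exp_add]; congr 1; ring
  refine ⟨?_, ?_, ?_, ?_⟩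
  · rw [hs5, hs4, polar_shift_expand₂, he5, he4]; ring
  · rw [hs0, hs4, polar_shift_expand₂, he4]; ring
  · rw [hs5, hs1, polar_shift_expand₂, he5]; ring
  · rw [hs0, hs1, polar_shift_expand₂, polar_comm ((δ 5 - δ 0) • U 5) (U 1 + U 4)]

/-- `|Λ|·|g| − |x| ≤ |x + Λ·g|`. [folklore] -/
theorem abs_mul_sub_abs_le_abs_add_mul (x Λ g : ℝ) : |Λ| * |g| - |x| ≤ |x + Λ * g| := by
  have t := abs_sub_abs_le_abs_sub (Λ * g) (-x)
  rw [abs_neg, abs_mul, sub_neg_eq_add, add_comm] at t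
  exact t

/-! ## 2. Scalar cores -/

/-- Core of the top rule, degree-2 slot downstream: `(5,4)` alive at both scales while `g'₀₄` is dominated forces `κκ'|Λ| ≤ κe + κ'`,
incompatible with `e/κ' + 2/κ < |Λ|`. [this work] -/
theorem mixTop_core_deg2 {κ κ' μ μ' E e e' Λ g₅₄ g₀₄ : ℝ} (hκ : 0 < κ) (hκ' : 0 < κ') (hμ : 0 < μ) (hE : 0 < E) (he' : 0 < e')
    (h54 : κ * μ ≤ |g₅₄|) (h04 : |g₀₄| ≤ μ)
    (halive : κ' * μ' ≤ E * (e * e') * |g₅₄|) (hdom : E * e' * |g₀₄ + Λ * g₅₄| ≤ μ')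
    (hΛ : 1 / κ' * e + 2 / κ < |Λ|) : False := by
  have hg : 0 < |g₅₄| := lt_of_lt_of_le (mul_pos hκ hμ) h54
  -- `κ'·|g₀₄ + Λ g₅₄| ≤ e·|g₅₄|`
  have h1 : κ' * (E * e' * |g₀₄ + Λ * g₅₄|) ≤ E * (e * e') * |g₅₄| := le_trans (mul_le_mul_of_nonneg_left hdom hκ'.le) halive
  have h2 : κ' * |g₀₄ + Λ * g₅₄| ≤ e * |g₅₄| := by
    have : (κ' * |g₀₄ + Λ * g₅₄|) * (E * e') ≤ (e * |g₅₄|) * (E * e') := by nlinarith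
    exact le_of_mul_le_mul_right this (mul_pos hE he')
  -- `|g₀₄ + Λ g₅₄| ≥ |Λ||g₅₄| − μ`
  have h3 : |Λ| * |g₅₄| - μ ≤ |g₀₄ + Λ * g₅₄| := by
    have t := abs_sub_abs_le_abs_sub (Λ * g₅₄) (-g₀₄)
    rw [abs_neg, abs_mul, show Λ * g₅₄ - -g₀₄ = g₀₄ + Λ * g₅₄ by ring] at t
    linarith
  -- `κκ'|Λ||g| ≤ κ e |g| + κκ'μ ≤ κ e |g| + κ'|g|`, divide by `|g| > 0`
  have h4 : κ' * |Λ| * |g₅₄| ≤ e * |g₅₄| + κ' * μ := by nlinarith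
  have h5 : (κ * κ' * |Λ| - κ * e - κ') * |g₅₄| ≤ 0 := by nlinarith
  have h6 : κ * κ' * |Λ| - κ * e - κ' ≤ 0 := by
    by_contra h
    push Not at h
    nlinarith [mul_pos h hg]
  -- clash with `κκ'(e/κ' + 2/κ) = κ e + 2κ' < κκ'|Λ|`
  have h7 := mul_lt_mul_of_pos_left hΛ (mul_pos hκ hκ')
  have i1 : κ' * (1 / κ') = 1 := mul_one_div_cancel hκ'.ne'
  have i2 : κ * (1 / κ) = 1 := mul_one_div_cancel hκ.ne'
  have h8 : κ * κ' * (1 / κ' * e + 2 / κ) = κ * e + 2 * κ' := by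
    rw [← mul_one_div (2 : ℝ) κ]
    linear_combination (κ * e) * i1 + (2 * κ') * i2
  rw [h8] at h7
  linarith

/-- Core of the top rule, degree-1 slot downstream: with `X = g₀₄ + Λg₅₄` (the downstream `(0,4)` entry up to weights), `A = g₀₁ + Λg₅₁`,
`(0,4)` alive downstream (`κ'μ' ≤ E e'|X|`) and `g'₀₁ = E(A + Λ'X)` dominated force `κ|Λ| < κ + 2` as soon as `|Λ'| > e'/κ' + 2/κ`,
incompatible with `1 + 2/κ < |Λ|`.  Stated abstractly so that the mirror slot `(5,1)` is the same lemma with `Λ ↔ Λ'`, `e' ↦ e`. [this work] -/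
theorem mixTop_core_deg1 {κ κ' μ μ' E e' Λ Λ' A X g : ℝ} (hκ : 0 < κ) (hκ' : 0 < κ') (hμ : 0 < μ) (hμ' : 0 < μ') (hE : 0 < E)
    (hg : κ * μ ≤ |g|) (hX : |Λ| * |g| - μ ≤ |X|) (hA : |A| ≤ μ * (1 + |Λ|))
    (halive : κ' * μ' ≤ E * e' * |X|) (hdom : E * |A + Λ' * X| ≤ μ') (hΛ' : 1 / κ' * e' + 2 / κ < |Λ'|)
    (hΛ : 1 + 2 / κ < |Λ|) : False := by
  -- `κ'|A + Λ'X| ≤ e'|X|`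
  have h1 : κ' * (E * |A + Λ' * X|) ≤ E * e' * |X| := le_trans (mul_le_mul_of_nonneg_left hdom hκ'.le) halive
  have h2 : κ' * |A + Λ' * X| ≤ e' * |X| := by
    have : (κ' * |A + Λ' * X|) * E ≤ (e' * |X|) * E := by nlinarith
    exact le_of_mul_le_mul_right this hE
  -- `|A + Λ'X| ≥ |Λ'||X| − |A|`
  have h3 : |Λ'| * |X| - |A| ≤ |A + Λ' * X| := by
    have t := abs_sub_abs_le_abs_sub (Λ' * X) (-A)
    rw [abs_neg, abs_mul, show Λ' * X - -A = A + Λ' * X by ring] at t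
    linarith
  -- `X ≠ 0`
  have hXpos : 0 < |X| := by
    have h0 : 0 < E * e' * |X| := lt_of_lt_of_le (mul_pos hκ' hμ') halive
    rcases (abs_nonneg X).lt_or_eq with h | h
    · exact h
    · rw [← h, mul_zero] at h0; exact absurd h0 (lt_irrefl _)
  -- `|X|(κ'|Λ'| − e') ≤ κ'|A| ≤ κ'μ(1+|Λ|)`
  have h4 : |X| * (κ' * |Λ'| - e') ≤ κ' * (μ * (1 + |Λ|)) := by nlinarith [abs_nonneg A]
  -- `κκ'(e'/κ' + 2/κ) = κe' + 2κ' < κκ'|Λ'|`, i.e. `κ(κ'|Λ'| − e') > 2κ'`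
  have h5 := mul_lt_mul_of_pos_left hΛ' (mul_pos hκ hκ')
  have i1 : κ' * (1 / κ') = 1 := mul_one_div_cancel hκ'.ne'
  have i2 : κ * (1 / κ) = 1 := mul_one_div_cancel hκ.ne'
  have h6 : κ * κ' * (1 / κ' * e' + 2 / κ) = κ * e' + 2 * κ' := by
    rw [← mul_one_div (2 : ℝ) κ]
    linear_combination (κ * e') * i1 + (2 * κ') * i2
  rw [h6] at h5
  -- `2κ'|X| < κ|X|(κ'|Λ'| − e') ≤ κκ'μ(1+|Λ|)` ⇒ `2|X| < κμ(1+|Λ|)`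
  have h7 : 2 * κ' * |X| < κ * κ' * (μ * (1 + |Λ|)) := by nlinarith
  have h8 : 2 * |X| < κ * (μ * (1 + |Λ|)) := by nlinarith
  -- with `|X| ≥ |Λ|κμ − μ`: `κ|Λ| < κ + 2`
  have h9 : |Λ| * (κ * μ) - μ ≤ |X| := le_trans (by nlinarith [abs_nonneg Λ]) hX
  have h10 : κ * |Λ| < κ + 2 := by nlinarith
  -- clash with `κ(1 + 2/κ) = κ + 2 < κ|Λ|`
  have h11 := mul_lt_mul_of_pos_left hΛ hκ
  have h12 : κ * (1 + 2 / κ) = κ + 2 := by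
    rw [← mul_one_div (2 : ℝ) κ]
    linear_combination 2 * i2
  rw [h12] at h11
  linarith

/-- THE TOP RULE AT ONE STAGE (letters `U`, exponents `δ`, shift `L`, all explicit): the first-scale bounds, the two second-scale dominations
`|g'₀₄|, |g'₀₁| ≤ μ'`, the transvection sizes `|Λ|, |Λ'|` beyond `e/κ' + 2/κ` and `1 + 2/κ`, and a downstream alive member `(5,4)`, `(0,4)` or
`(5,1)` at level `κ'μ'` are contradictory. [this work] -/
theorem mixTop_stage (δ : Fin 6 → ℝ) (U : Fin 6 → Matrix (Fin 2) (Fin 2) ℝ) (L μ μ' κ κ' : ℝ) (hμ : 0 < μ) (hμ' : 0 < μ')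
    (hκ : 0 < κ) (hκ' : 0 < κ')
    (h54 : κ * μ ≤ |polar ((δ 5 - δ 0) • U 5) ((δ 4 - δ 1) • U 4)|)
    (h04 : |polar (U 0 + U 5) ((δ 4 - δ 1) • U 4)| ≤ μ) (h51 : |polar ((δ 5 - δ 0) • U 5) (U 1 + U 4)| ≤ μ)
    (h01 : |polar (U 0 + U 5) (U 1 + U 4)| ≤ μ)
    (hdom04 : |polar (Real.exp (δ 0 * L) • U 0 + Real.exp (δ 5 * L) • U 5) ((δ 4 - δ 1) • (Real.exp (δ 4 * L) • U 4))| ≤ μ')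
    (hdom01 : |polar (Real.exp (δ 0 * L) • U 0 + Real.exp (δ 5 * L) • U 5) (Real.exp (δ 1 * L) • U 1 + Real.exp (δ 4 * L) • U 4)| ≤ μ')
    (hΛa : 1 / κ' * Real.exp ((δ 5 - δ 0) * L) + 2 / κ < |dslope (fun y : ℝ => Real.exp (y * L)) 0 (δ 5 - δ 0)|)
    (hΛ'a : 1 / κ' * Real.exp ((δ 4 - δ 1) * L) + 2 / κ < |dslope (fun y : ℝ => Real.exp (y * L)) 0 (δ 4 - δ 1)|)
    (hΛb : 1 + 2 / κ < |dslope (fun y : ℝ => Real.exp (y * L)) 0 (δ 5 - δ 0)|)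
    (hΛ'b : 1 + 2 / κ < |dslope (fun y : ℝ => Real.exp (y * L)) 0 (δ 4 - δ 1)|)
    (halive : κ' * μ' ≤ |polar ((δ 5 - δ 0) • (Real.exp (δ 5 * L) • U 5)) ((δ 4 - δ 1) • (Real.exp (δ 4 * L) • U 4))| ∨
      κ' * μ' ≤ |polar (Real.exp (δ 0 * L) • U 0 + Real.exp (δ 5 * L) • U 5) ((δ 4 - δ 1) • (Real.exp (δ 4 * L) • U 4))| ∨
      κ' * μ' ≤ |polar ((δ 5 - δ 0) • (Real.exp (δ 5 * L) • U 5)) (Real.exp (δ 1 * L) • U 1 + Real.exp (δ 4 * L) • U 4)|) : False := by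
  obtain ⟨i54, i04, i51, i01⟩ := mixed_frameShift δ U L
  have hEpos : 0 < Real.exp (δ 0 * L) * Real.exp (δ 1 * L) := mul_pos (Real.exp_pos _) (Real.exp_pos _)
  have hepos : 0 < Real.exp ((δ 5 - δ 0) * L) := Real.exp_pos _
  have he'pos : 0 < Real.exp ((δ 4 - δ 1) * L) := Real.exp_pos _
  rw [i04, abs_mul, abs_of_pos (mul_pos hEpos he'pos)] at hdom04
  rw [i01, abs_mul, abs_of_pos hEpos] at hdom01
  -- lower bounds `|Λ||g54| − μ ≤ |X|`, `|Λ'||g54| − μ ≤ |Y|`, upper bounds on `A`, `A'`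
  have hX : |dslope (fun y : ℝ => Real.exp (y * L)) 0 (δ 5 - δ 0)| * |polar ((δ 5 - δ 0) • U 5) ((δ 4 - δ 1) • U 4)| - μ
      ≤ |polar (U 0 + U 5) ((δ 4 - δ 1) • U 4)
          + dslope (fun y : ℝ => Real.exp (y * L)) 0 (δ 5 - δ 0) * polar ((δ 5 - δ 0) • U 5) ((δ 4 - δ 1) • U 4)| := by
    have t := abs_mul_sub_abs_le_abs_add_mul (polar (U 0 + U 5) ((δ 4 - δ 1) • U 4))
      (dslope (fun y : ℝ => Real.exp (y * L)) 0 (δ 5 - δ 0)) (polar ((δ 5 - δ 0) • U 5) ((δ 4 - δ 1) • U 4))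
    linarith
  have hY : |dslope (fun y : ℝ => Real.exp (y * L)) 0 (δ 4 - δ 1)| * |polar ((δ 5 - δ 0) • U 5) ((δ 4 - δ 1) • U 4)| - μ
      ≤ |polar ((δ 5 - δ 0) • U 5) (U 1 + U 4)
          + dslope (fun y : ℝ => Real.exp (y * L)) 0 (δ 4 - δ 1) * polar ((δ 5 - δ 0) • U 5) ((δ 4 - δ 1) • U 4)| := by
    have t := abs_mul_sub_abs_le_abs_add_mul (polar ((δ 5 - δ 0) • U 5) (U 1 + U 4))
      (dslope (fun y : ℝ => Real.exp (y * L)) 0 (δ 4 - δ 1)) (polar ((δ 5 - δ 0) • U 5) ((δ 4 - δ 1) • U 4))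
    linarith
  have hA : |polar (U 0 + U 5) (U 1 + U 4) + dslope (fun y : ℝ => Real.exp (y * L)) 0 (δ 5 - δ 0) * polar ((δ 5 - δ 0) • U 5) (U 1 + U 4)|
      ≤ μ * (1 + |dslope (fun y : ℝ => Real.exp (y * L)) 0 (δ 5 - δ 0)|) := by
    have t := abs_add_le (polar (U 0 + U 5) (U 1 + U 4)) (dslope (fun y : ℝ => Real.exp (y * L)) 0 (δ 5 - δ 0) * polar ((δ 5 - δ 0) • U 5) (U 1 + U 4))
    rw [abs_mul] at t
    nlinarith [abs_nonneg (dslope (fun y : ℝ => Real.exp (y * L)) 0 (δ 5 - δ 0))]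
  have hA' : |polar (U 0 + U 5) (U 1 + U 4) + dslope (fun y : ℝ => Real.exp (y * L)) 0 (δ 4 - δ 1) * polar (U 0 + U 5) ((δ 4 - δ 1) • U 4)|
      ≤ μ * (1 + |dslope (fun y : ℝ => Real.exp (y * L)) 0 (δ 4 - δ 1)|) := by
    have t := abs_add_le (polar (U 0 + U 5) (U 1 + U 4)) (dslope (fun y : ℝ => Real.exp (y * L)) 0 (δ 4 - δ 1) * polar (U 0 + U 5) ((δ 4 - δ 1) • U 4))
    rw [abs_mul] at t
    nlinarith [abs_nonneg (dslope (fun y : ℝ => Real.exp (y * L)) 0 (δ 4 - δ 1))]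
  rcases halive with h | h | h
  · -- `(5,4)` downstream
    rw [i54, abs_mul, abs_of_pos (mul_pos hEpos (mul_pos hepos he'pos))] at h
    exact mixTop_core_deg2 hκ hκ' hμ hEpos he'pos h54 h04 h hdom04 hΛa
  · -- `(0,4)` downstream
    rw [i04, abs_mul, abs_of_pos (mul_pos hEpos he'pos)] at h
    have hdom01' : Real.exp (δ 0 * L) * Real.exp (δ 1 * L) *
        |(polar (U 0 + U 5) (U 1 + U 4) + dslope (fun y : ℝ => Real.exp (y * L)) 0 (δ 5 - δ 0) * polar ((δ 5 - δ 0) • U 5) (U 1 + U 4))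
          + dslope (fun y : ℝ => Real.exp (y * L)) 0 (δ 4 - δ 1) * (polar (U 0 + U 5) ((δ 4 - δ 1) • U 4)
            + dslope (fun y : ℝ => Real.exp (y * L)) 0 (δ 5 - δ 0) * polar ((δ 5 - δ 0) • U 5) ((δ 4 - δ 1) • U 4))| ≤ μ' := by
      refine le_of_eq_of_le ?_ hdom01
      congr 2; ring
    exact mixTop_core_deg1 hκ hκ' hμ hμ' hEpos h54 hX hA h hdom01' hΛ'a hΛb
  · -- `(5,1)` downstream
    rw [i51, abs_mul, abs_of_pos (mul_pos hEpos hepos)] at h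
    have hdom01' : Real.exp (δ 0 * L) * Real.exp (δ 1 * L) *
        |(polar (U 0 + U 5) (U 1 + U 4) + dslope (fun y : ℝ => Real.exp (y * L)) 0 (δ 4 - δ 1) * polar (U 0 + U 5) ((δ 4 - δ 1) • U 4))
          + dslope (fun y : ℝ => Real.exp (y * L)) 0 (δ 5 - δ 0) * (polar ((δ 5 - δ 0) • U 5) (U 1 + U 4)
            + dslope (fun y : ℝ => Real.exp (y * L)) 0 (δ 4 - δ 1) * polar ((δ 5 - δ 0) • U 5) ((δ 4 - δ 1) • U 4))| ≤ μ' := by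
      refine le_of_eq_of_le ?_ hdom01
      congr 2; ring
    exact mixTop_core_deg1 hκ hκ' hμ hμ' hEpos h54 hY hA' h hdom01' hΛa hΛ'b

/-! ## 3. The top rule -/

/-- **THE MIXED CLASS `δ₀+δ₁`, TOP RULE (face form) — `MixTop26` of rev 8 of `Lines/wall_bubbling_ConfluentDoor.lean` IS A THEOREM.**
Letters `U^ν` recentred at the first cluster, exponents `δ^ν → δ0` ON THE FACE `δ0 5 = δ0 0`, `δ0 4 = δ0 1`, shifts `L_ν → +∞`; the two-dslope
frames at both scales with dominated, Gram-normalised convergent entries (binder BYTE-EXACT the hypothesis `hMixTop` of W1 #52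
`twoPair_noTwenties_of_mixedRules`).  If the degree-2 member `(5,4)` of the mixed class is alive in the first limit, then `(5,4)`, `(0,4)`, `(5,1)`
are all dead in the second. [this work] -/
theorem mixTop_face (δ0 : Fin 6 → ℝ) (h50 : δ0 5 = δ0 0) (h41 : δ0 4 = δ0 1)
    (δs : ℕ → Fin 6 → ℝ) (hδ : ∀ l, Tendsto (fun ν => δs ν l) atTop (𝓝 (δ0 l)))
    (U : ℕ → Fin 6 → Matrix (Fin 2) (Fin 2) ℝ) (L : ℕ → ℝ) (hL : Tendsto L atTop atTop)
    (μ μ' : ℕ → ℝ) (hμ : ∀ ν, 0 < μ ν) (hμ' : ∀ ν, 0 < μ' ν)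
    (hdom : ∀ ν a b, |polar (if a = 0 then U ν 0 + U ν 5 else if a = 1 then U ν 1 + U ν 4
        else if a = 4 then (δs ν 4 - δs ν 1) • U ν 4 else if a = 5 then (δs ν 5 - δs ν 0) • U ν 5 else U ν a)
      (if b = 0 then U ν 0 + U ν 5 else if b = 1 then U ν 1 + U ν 4
        else if b = 4 then (δs ν 4 - δs ν 1) • U ν 4 else if b = 5 then (δs ν 5 - δs ν 0) • U ν 5 else U ν b)| ≤ μ ν)
    (hdom' : ∀ ν a b, |polar (if a = 0 then Real.exp (δs ν 0 * L ν) • U ν 0 + Real.exp (δs ν 5 * L ν) • U ν 5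
        else if a = 1 then Real.exp (δs ν 1 * L ν) • U ν 1 + Real.exp (δs ν 4 * L ν) • U ν 4
        else if a = 4 then (δs ν 4 - δs ν 1) • (Real.exp (δs ν 4 * L ν) • U ν 4)
        else if a = 5 then (δs ν 5 - δs ν 0) • (Real.exp (δs ν 5 * L ν) • U ν 5) else Real.exp (δs ν a * L ν) • U ν a)
      (if b = 0 then Real.exp (δs ν 0 * L ν) • U ν 0 + Real.exp (δs ν 5 * L ν) • U ν 5
        else if b = 1 then Real.exp (δs ν 1 * L ν) • U ν 1 + Real.exp (δs ν 4 * L ν) • U ν 4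
        else if b = 4 then (δs ν 4 - δs ν 1) • (Real.exp (δs ν 4 * L ν) • U ν 4)
        else if b = 5 then (δs ν 5 - δs ν 0) • (Real.exp (δs ν 5 * L ν) • U ν 5) else Real.exp (δs ν b * L ν) • U ν b)| ≤ μ' ν)
    (Γ Γ' : Fin 6 → Fin 6 → ℝ)
    (hΓ : ∀ a b, Tendsto (fun ν => polar (if a = 0 then U ν 0 + U ν 5 else if a = 1 then U ν 1 + U ν 4
        else if a = 4 then (δs ν 4 - δs ν 1) • U ν 4 else if a = 5 then (δs ν 5 - δs ν 0) • U ν 5 else U ν a)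
      (if b = 0 then U ν 0 + U ν 5 else if b = 1 then U ν 1 + U ν 4
        else if b = 4 then (δs ν 4 - δs ν 1) • U ν 4 else if b = 5 then (δs ν 5 - δs ν 0) • U ν 5 else U ν b) / μ ν) atTop (𝓝 (Γ a b)))
    (hΓ' : ∀ a b, Tendsto (fun ν => polar (if a = 0 then Real.exp (δs ν 0 * L ν) • U ν 0 + Real.exp (δs ν 5 * L ν) • U ν 5
        else if a = 1 then Real.exp (δs ν 1 * L ν) • U ν 1 + Real.exp (δs ν 4 * L ν) • U ν 4
        else if a = 4 then (δs ν 4 - δs ν 1) • (Real.exp (δs ν 4 * L ν) • U ν 4)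
        else if a = 5 then (δs ν 5 - δs ν 0) • (Real.exp (δs ν 5 * L ν) • U ν 5) else Real.exp (δs ν a * L ν) • U ν a)
      (if b = 0 then Real.exp (δs ν 0 * L ν) • U ν 0 + Real.exp (δs ν 5 * L ν) • U ν 5
        else if b = 1 then Real.exp (δs ν 1 * L ν) • U ν 1 + Real.exp (δs ν 4 * L ν) • U ν 4
        else if b = 4 then (δs ν 4 - δs ν 1) • (Real.exp (δs ν 4 * L ν) • U ν 4)
        else if b = 5 then (δs ν 5 - δs ν 0) • (Real.exp (δs ν 5 * L ν) • U ν 5) else Real.exp (δs ν b * L ν) • U ν b) / μ' ν) atTop (𝓝 (Γ' a b))) :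
    Γ 5 4 ≠ 0 → Γ' 5 4 = 0 ∧ Γ' 0 4 = 0 ∧ Γ' 5 1 = 0 := by
  intro h1
  set κ : ℝ := |Γ 5 4| / 2 with hκ
  have hκpos : 0 < κ := by rw [hκ]; exact half_pos (abs_pos.mpr h1)
  have f50 : ((5 : Fin 6) = 0) = False := by simp
  have f51 : ((5 : Fin 6) = 1) = False := by simp
  have f54 : ((5 : Fin 6) = 4) = False := by simp
  have f40 : ((4 : Fin 6) = 0) = False := by simp
  have f41 : ((4 : Fin 6) = 1) = False := by simp
  have f10 : ((1 : Fin 6) = 0) = False := by simp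
  have hw0 : Tendsto (fun ν => δs ν 5 - δs ν 0) atTop (𝓝 0) := by
    have := (hδ 5).sub (hδ 0)
    rw [h50, sub_self] at this
    exact this
  have hw1 : Tendsto (fun ν => δs ν 4 - δs ν 1) atTop (𝓝 0) := by
    have := (hδ 4).sub (hδ 1)
    rw [h41, sub_self] at this
    exact this
  -- upstream: `(5,4)` alive, eventually
  have e1 : ∀ᶠ ν in atTop, κ * μ ν ≤ |polar ((δs ν 5 - δs ν 0) • U ν 5) ((δs ν 4 - δs ν 1) • U ν 4)| := by
    have h := ((hΓ 5 4).abs).eventually_const_lt (show κ < |Γ 5 4| by rw [hκ]; linarith [abs_pos.mpr h1])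
    filter_upwards [h] with ν hν
    simp only [f50, f51, f54, f40, f41, if_false, if_true] at hν
    rw [abs_div, abs_of_pos (hμ ν), lt_div_iff₀ (hμ ν)] at hν
    exact hν.le
  -- `|Λ|`, `|Λ'|` eventually exceed `1 + 2/κ`
  have ebΛ : ∀ᶠ ν in atTop, 0 * Real.exp ((δs ν 5 - δs ν 0) * L ν) + (1 + 2 / κ)
      < |dslope (fun y : ℝ => Real.exp (y * L ν)) 0 (δs ν 5 - δs ν 0)| :=
    eventually_dslope_exp_gt (fun ν => δs ν 5 - δs ν 0) L hw0 hL 0 (1 + 2 / κ) le_rfl (by positivity)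
  have ebΛ' : ∀ᶠ ν in atTop, 0 * Real.exp ((δs ν 4 - δs ν 1) * L ν) + (1 + 2 / κ)
      < |dslope (fun y : ℝ => Real.exp (y * L ν)) 0 (δs ν 4 - δs ν 1)| :=
    eventually_dslope_exp_gt (fun ν => δs ν 4 - δs ν 1) L hw1 hL 0 (1 + 2 / κ) le_rfl (by positivity)
  -- the contradiction engine: a downstream alive member of the mixed class (other than `(0,1)`) is impossible
  have engine : ∀ (a' b' : Fin 6), (a' = 5 ∧ b' = 4) ∨ (a' = 0 ∧ b' = 4) ∨ (a' = 5 ∧ b' = 1) → Γ' a' b' ≠ 0 → False := by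
    intro a' b' hab hne
    set κ' : ℝ := |Γ' a' b'| / 2 with hκ'
    have hκ'pos : 0 < κ' := by rw [hκ']; exact half_pos (abs_pos.mpr hne)
    have e2 : ∀ᶠ ν in atTop, κ' * μ' ν ≤ |polar
        (if a' = 0 then Real.exp (δs ν 0 * L ν) • U ν 0 + Real.exp (δs ν 5 * L ν) • U ν 5
          else if a' = 1 then Real.exp (δs ν 1 * L ν) • U ν 1 + Real.exp (δs ν 4 * L ν) • U ν 4
          else if a' = 4 then (δs ν 4 - δs ν 1) • (Real.exp (δs ν 4 * L ν) • U ν 4)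
          else if a' = 5 then (δs ν 5 - δs ν 0) • (Real.exp (δs ν 5 * L ν) • U ν 5) else Real.exp (δs ν a' * L ν) • U ν a')
        (if b' = 0 then Real.exp (δs ν 0 * L ν) • U ν 0 + Real.exp (δs ν 5 * L ν) • U ν 5
          else if b' = 1 then Real.exp (δs ν 1 * L ν) • U ν 1 + Real.exp (δs ν 4 * L ν) • U ν 4
          else if b' = 4 then (δs ν 4 - δs ν 1) • (Real.exp (δs ν 4 * L ν) • U ν 4)
          else if b' = 5 then (δs ν 5 - δs ν 0) • (Real.exp (δs ν 5 * L ν) • U ν 5) else Real.exp (δs ν b' * L ν) • U ν b')| := by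
      have h := ((hΓ' a' b').abs).eventually_const_lt (show κ' < |Γ' a' b'| by rw [hκ']; linarith [abs_pos.mpr hne])
      filter_upwards [h] with ν hν
      rw [abs_div, abs_of_pos (hμ' ν), lt_div_iff₀ (hμ' ν)] at hν
      exact hν.le
    have eaΛ : ∀ᶠ ν in atTop, (1 / κ') * Real.exp ((δs ν 5 - δs ν 0) * L ν) + (2 / κ)
        < |dslope (fun y : ℝ => Real.exp (y * L ν)) 0 (δs ν 5 - δs ν 0)| :=
      eventually_dslope_exp_gt (fun ν => δs ν 5 - δs ν 0) L hw0 hL (1 / κ') (2 / κ) (by positivity) (by positivity)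
    have eaΛ' : ∀ᶠ ν in atTop, (1 / κ') * Real.exp ((δs ν 4 - δs ν 1) * L ν) + (2 / κ)
        < |dslope (fun y : ℝ => Real.exp (y * L ν)) 0 (δs ν 4 - δs ν 1)| :=
      eventually_dslope_exp_gt (fun ν => δs ν 4 - δs ν 1) L hw1 hL (1 / κ') (2 / κ) (by positivity) (by positivity)
    have hfalse : ∀ᶠ ν : ℕ in atTop, False := by
      filter_upwards [e1, e2, ebΛ, ebΛ', eaΛ, eaΛ'] with ν hν1 hν2 hνbΛ hνbΛ' hνaΛ hνaΛ'
      rw [zero_mul, zero_add] at hνbΛ hνbΛ'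
      have h04le := hdom ν 0 4
      simp only [f40, f41, if_false, if_true] at h04le
      have h51le := hdom ν 5 1
      simp only [f50, f51, f54, f10, if_false, if_true] at h51le
      have h01le := hdom ν 0 1
      simp only [f10, if_false, if_true] at h01le
      have hdom04 := hdom' ν 0 4
      simp only [f40, f41, if_false, if_true] at hdom04
      have hdom01 := hdom' ν 0 1
      simp only [f10, if_false, if_true] at hdom01
      rcases hab with ⟨rfl, rfl⟩ | ⟨rfl, rfl⟩ | ⟨rfl, rfl⟩
      · simp only [f50, f51, f54, f40, f41, if_false, if_true] at hν2
        exact mixTop_stage (δs ν) (U ν) (L ν) (μ ν) (μ' ν) κ κ' (hμ ν) (hμ' ν) hκpos hκ'pos hν1 h04le h51le h01le hdom04 hdom01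
          hνaΛ hνaΛ' hνbΛ hνbΛ' (Or.inl hν2)
      · simp only [f40, f41, if_false, if_true] at hν2
        exact mixTop_stage (δs ν) (U ν) (L ν) (μ ν) (μ' ν) κ κ' (hμ ν) (hμ' ν) hκpos hκ'pos hν1 h04le h51le h01le hdom04 hdom01
          hνaΛ hνaΛ' hνbΛ hνbΛ' (Or.inr (Or.inl hν2))
      · simp only [f50, f51, f54, f10, if_false, if_true] at hν2
        exact mixTop_stage (δs ν) (U ν) (L ν) (μ ν) (μ' ν) κ κ' (hμ ν) (hμ' ν) hκpos hκ'pos hν1 h04le h51le h01le hdom04 hdom01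
          hνaΛ hνaΛ' hνbΛ hνbΛ' (Or.inr (Or.inr hν2))
    exact hfalse.exists.elim fun _ h => h
  refine ⟨?_, ?_, ?_⟩
  · by_contra h; exact engine 5 4 (Or.inl ⟨rfl, rfl⟩) h
  · by_contra h; exact engine 0 4 (Or.inr (Or.inl ⟨rfl, rfl⟩)) h
  · by_contra h; exact engine 5 1 (Or.inr (Or.inr ⟨rfl, rfl⟩)) h

end Summit.ValiantsHypothesis.ValiantsHypothesis.Theorems.LacunarySymmetroidMatrixDescartes.WallBubbling
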